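import Summits.QuantumFields.YangMills.Theorems.FluctuationComparisonRegPrIntLSupTailReduction
import Literature.MathematicalPhysics.QuantumFieldTheory.Balaban1983to89.T3InteriorExcision
import Literature.MathematicalPhysics.QuantumFieldTheory.Balaban1983to89.T3PrintedMinimiserExistence
import HarnessLib

/-!
# `FluctuationComparisonRegPrIntLSupTailReductionInt` — THE INTERIOR-WINDOW EDITION OF THE TAILSUP₁ DOOR (LINE g21-2 `tailsup_one` v1.4 row TAILSUP₁∘ after R3-FLIN)
# (crux `UnitScaleTilt.FluctuationComparisonRegPrIntL`, stmt-QuantumFields-20520; row TAILSUP₁∘ `WindowOddsSupDepthOneIntCan`; companion of ✓`…SupTailReduction` (A))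

Cell `ym3-torus` (YM ladder rung R3 = continuum SU(2) Yang–Mills on T³ — a RUNG, NOT the Clay problem: not d = 4, not infinite volume, not a mass gap);
width seat `ym-ust-20520-w3` (gen 17); helper `--supports stmt-QuantumFields-20520`.  THEOREMS ONLY (0 `def`, 0 `sorry`, default heartbeats).

WHAT.  R3-FLIN (instrument seat, 02:14Z) showed the window-edge forcing number fires at the binding `L = 3` for the FULL window, so the ideator's v1.4 reads every
WINDOW clause on the INTERIOR window `{PlaqSmall (θBal L γ (c·b₀) p₀ J)}` (`c ∈ (0, c₀]`, `c₀ ≤ 1` chosen after `L`) while the HISTORY stays at profile `b₀`.  ✓A's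
`window_logOdds_bounds` has window and history at the same `b₀`; this file re-runs it with the two decoupled and threads the row:
* §1 ★★`window_logOdds_bounds_int` — COND-ODDS at `(J, K)` stated on the interior window (setwise `Gibbs_K(D⁻¹B) ≤ e^{τ}·Gibbs_K(D⁻¹B ∩ histGood(b₀) K J)` for `B` inside
  the `c·b₀`-window) + a continuous positive interior-window version `ρ` + interior window ⊆ `regSet(heightDensity^{histGood(b₀)})` + positivity ⟹
  `0 ≤ log ρ − (−log Z_K) − log q^{hist}_can ≤ τ` on the interior window (✓A `heightDensityCan_le_of_setwise` ×2, ✓A `heightDensityCan_univ_eqOn` at `b₀ ↦ c·b₀`).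
* §2 ★★★`windowOddsSupDepthOneIntCan_of_condGoodOddsDepthOneInt : ⟨COND-ODDS₁∘⟩ → ⟨TAILSUP₁∘ `WindowOddsSupDepthOneIntCan` VERBATIM⟩` — WREG ✓`windowRegularity` at `b₀` gives
  the `regSet` clause on the full window, hence on the interior one (`θBal_mul_le` + `plaqSmall_of_le`, couplings capped `γ ≤ 1`).
HONEST SCOPE.  Bookkeeping; COND-ODDS₁∘ is the HYPOTHESIS (reachable from the fibre by ✓C ∕ ✓E ∕ ✓J with `W := interior window`); TAILSUP₁∘, MOD₁∘, LFR♯ᶜ∘, S2β,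
20520, `YM3TorusSU2` NOT proved; the Yang–Mills mass gap is NOT proved.
References: [Balaban1985UV3] (2) p. 256, (7) p. 257, (38)–(40) p. 266; [Balaban1987RG1] (0.13) p. 254.
-/

noncomputable section

set_option autoImplicit false

open MeasureTheory Filter Topology Set
open scoped ENNReal NNReal BigOperators
open Literature.MathematicalPhysics.QuantumFieldTheory.Balaban1983to89
open Literature.MathematicalPhysics.QuantumFieldTheory.Balaban1983to89.T3ContinuumYM3Torus
open Literature.MathematicalPhysics.QuantumFieldTheory.Balaban1983to89.T3NestedUnitLaws
open Literature.MathematicalPhysics.QuantumFieldTheory.Balaban1983to89.T3UnitLawDensityEML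
open Literature.MathematicalPhysics.QuantumFieldTheory.Balaban1983to89.T3UnitScaleTilt
open Literature.MathematicalPhysics.QuantumFieldTheory.Balaban1983to89.T3TiltDescent
open Literature.MathematicalPhysics.QuantumFieldTheory.Balaban1983to89.Missing
open scoped Literature.MathematicalPhysics.QuantumFieldTheory.Balaban1983to89.T3OrbitAverage
open Summit.QuantumFields.YangMills.Theorems.FluctuationComparisonRegPrIntLWregGlue (heightDensityCan)
open Summit.QuantumFields.YangMills.Theorems.FluctuationComparisonRegPrIntLWregAssembly (isOpen_setOf_plaqSmall₂)
open Summit.QuantumFields.YangMills.Theorems.FluctuationComparisonRegPrIntLOddsLedgerVers (tower_eq_map_descendTo)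

namespace Summit.QuantumFields.YangMills.Theorems.FluctuationComparisonRegPrIntLSupTailReductionInt

open Summit.QuantumFields.YangMills.Theorems.FluctuationComparisonRegPrIntLSupTailReduction
  (heightDensityCan_le_of_setwise heightDensityCan_univ_eqOn)

/-! ## §1 The log-odds bounds on the INTERIOR window (window at `c·b₀`, history at `b₀`) -/

section Window

variable (F : T3Family) {γ : ℝ} (c b₀ p₀ : ℝ) {J K : ℕ} (hJK : J ≤ K)

/-- ★★ **THE LOG-ODDS BOUNDS AT ONE `(J, K)` ON THE INTERIOR WINDOW**: as ✓A `window_logOdds_bounds`, with every WINDOW clause at `θBal F.L γ (c * b₀) p₀ J` and the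
HISTORY `histGood F ℰp (θBal F.L γ b₀ p₀) K J` unchanged; the `regSet` clause is asked on the interior window itself. [cite: Balaban1985UV3, (38)-(40) p.266] -/
theorem window_logOdds_bounds_int (hγ : 0 < γ) {τ : ℝ}
    (hset : ∀ B : Set (GaugeField (F.P J) 0 (Matrix.specialUnitaryGroup (Fin 2) ℂ)), MeasurableSet B →
      B ⊆ {U | PlaqSmall (θBal F.L γ (c * b₀) p₀ J) U} →
      gibbsK F ℰp γ K (descendTo F ℰp J K hJK ⁻¹' B) ≤
        ENNReal.ofReal (Real.exp τ) * gibbsK F ℰp γ K (descendTo F ℰp J K hJK ⁻¹' B ∩ histGood F ℰp (θBal F.L γ b₀ p₀) K J))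
    (ρ : GaugeField (F.P J) 0 (Matrix.specialUnitaryGroup (Fin 2) ℂ) → ℝ)
    (hρpos : ∀ U, PlaqSmall (θBal F.L γ (c * b₀) p₀ J) U → 0 < ρ U)
    (hlaw : Measure.map (descendTo F ℰp J K hJK) (gibbsK F ℰp γ K) =
      (fieldMeasure (F.P J) 0 (Matrix.specialUnitaryGroup (Fin 2) ℂ)).withDensity (fun U => ENNReal.ofReal (ρ U)))
    (hρc : ContinuousOn ρ {U | PlaqSmall (θBal F.L γ (c * b₀) p₀ J) U})
    (hreg : {U : GaugeField (F.P J) 0 (Matrix.specialUnitaryGroup (Fin 2) ℂ) | PlaqSmall (θBal F.L γ (c * b₀) p₀ J) U} ⊆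
      Node00.regSet (fieldMeasure (F.P J) 0 (Matrix.specialUnitaryGroup (Fin 2) ℂ)) (heightDensity F γ hJK (histGood F ℰp (θBal F.L γ b₀ p₀) K J)))
    (hpos : ∀ U : GaugeField (F.P J) 0 (Matrix.specialUnitaryGroup (Fin 2) ℂ), PlaqSmall (θBal F.L γ (c * b₀) p₀ J) U →
      0 < heightDensityCan F γ hJK (histGood F ℰp (θBal F.L γ b₀ p₀) K J) U) :
    ∀ U : GaugeField (F.P J) 0 (Matrix.specialUnitaryGroup (Fin 2) ℂ), PlaqSmall (θBal F.L γ (c * b₀) p₀ J) U →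
      0 ≤ Real.log (ρ U) - (-Real.log (partitionFn (G := Matrix.specialUnitaryGroup (Fin 2) ℂ) (F.P K) ((F.scheme ℰp γ).β K))) -
          Real.log (heightDensityCan F γ hJK (histGood F ℰp (θBal F.L γ b₀ p₀) K J) U) ∧
      Real.log (ρ U) - (-Real.log (partitionFn (G := Matrix.specialUnitaryGroup (Fin 2) ℂ) (F.P K) ((F.scheme ℰp γ).β K))) -
          Real.log (heightDensityCan F γ hJK (histGood F ℰp (θBal F.L γ b₀ p₀) K J) U) ≤ τ := by
  haveI := B12ContinuousTransportInvariance.isOpenPosMeasure_fieldMeasure_SU (N := 2) (F.P J) 0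
  set μ := fieldMeasure (F.P J) 0 (Matrix.specialUnitaryGroup (Fin 2) ℂ) with hμ
  set W : Set (GaugeField (F.P J) 0 (Matrix.specialUnitaryGroup (Fin 2) ℂ)) := {U | PlaqSmall (θBal F.L γ (c * b₀) p₀ J) U} with hW
  set Z : ℝ := partitionFn (G := Matrix.specialUnitaryGroup (Fin 2) ℂ) (F.P K) ((F.scheme ℰp γ).β K) with hZ
  set G := histGood F ℰp (θBal F.L γ b₀ p₀) K J with hG
  have hZpos : 0 < Z := partitionFn_pos' _ (F.scheme_β_nonneg ℰp hγ.le K)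
  have hWo : IsOpen W := isOpen_setOf_plaqSmall₂ (F.P J) 0 _
  have hGm : MeasurableSet G := measurableSet_histGood F ℰp measurableE_ℰp _ K J
  have hEq := heightDensityCan_univ_eqOn F (c * b₀) p₀ hJK hγ ρ hρpos hlaw hρc
  have hcU : ContinuousOn (heightDensityCan F γ hJK Set.univ) W := (continuousOn_const.mul hρc).congr hEq
  have hcG : ContinuousOn (heightDensityCan F γ hJK G) W := by
    have : heightDensityCan F γ hJK G = Node00.canonVersion μ (heightDensity F γ hJK G) := rfl
    rw [this]
    exact Node00.continuousOn_canonVersion.mono hreg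
  have hup : ∀ U ∈ W, heightDensityCan F γ hJK Set.univ U ≤ Real.exp τ * heightDensityCan F γ hJK G U := by
    refine heightDensityCan_le_of_setwise F hJK hγ MeasurableSet.univ hGm hWo (Real.exp_pos τ).le ?_ hcU hcG
    intro B hB hBW
    rw [Set.inter_univ]
    exact hset B hB hBW
  have hlow : ∀ U ∈ W, heightDensityCan F γ hJK G U ≤ 1 * heightDensityCan F γ hJK Set.univ U := by
    refine heightDensityCan_le_of_setwise F hJK hγ hGm MeasurableSet.univ hWo zero_le_one ?_ hcG hcU
    intro B hB _
    rw [ENNReal.ofReal_one, one_mul, Set.inter_univ]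
    exact measure_mono Set.inter_subset_left
  intro U hU
  have hGpos : 0 < heightDensityCan F γ hJK G U := hpos U hU
  have hρU : 0 < ρ U := hρpos U hU
  have hUpos : 0 < heightDensityCan F γ hJK Set.univ U := lt_of_lt_of_le hGpos (by simpa only [one_mul] using hlow U hU)
  have hlogU : Real.log (ρ U) - (-Real.log Z) = Real.log (heightDensityCan F γ hJK Set.univ U) := by
    rw [hEq hU, Real.log_mul hZpos.ne' hρU.ne']
    ring
  rw [hlogU]
  constructor
  · have := Real.log_le_log hGpos (by simpa only [one_mul] using hlow U hU)
    linarith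
  · have h1 : Real.log (heightDensityCan F γ hJK Set.univ U) ≤ Real.log (Real.exp τ * heightDensityCan F γ hJK G U) :=
      Real.log_le_log hUpos (hup U hU)
    rw [Real.log_mul (Real.exp_pos τ).ne' hGpos.ne', Real.log_exp] at h1
    linarith

end Window

/-! ## §2 THE DOOR: COND-ODDS₁∘ ⇒ TAILSUP₁∘ (text of LINE g21-2 v1.4 verbatim) -/

/-- ★★★ **TAILSUP₁∘ ⟸ COND-ODDS₁∘** (LINE g21-2 v1.4's `WindowOddsSupDepthOneIntCan`, text VERBATIM with `heightDensityCan` = ✓`…WregGlue.heightDensityCan`): the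
hypothesis is TAILSUP₁∘'s own prefix (`∀ L, ∃ c₀ ∈ (0,1], ∀ c ∈ (0,c₀], ∃ pS …`) and modulus clause followed by the SETWISE conditional-odds inequality on the
INTERIOR window `Gibbs_{J+1}(D_{J,J+1}⁻¹B) ≤ e^{τ J}·Gibbs_{J+1}(D_{J,J+1}⁻¹B ∩ histGood(b₀) (J+1) J)` for measurable `B ⊆ {PlaqSmall (θBal F.L γ (c·b₀) p₀ J)}`.
Inside: ✓`tower_eq_map_descendTo`, §1, WREG ✓`windowRegularity` at `b₀` restricted to the interior window (`θBal_mul_le`, `plaqSmall_of_le`; couplings capped at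
`γ ≤ 1`). [cite: Balaban1985UV3, (38)-(40) p.266; Balaban1985Averaging, (10) p.19] -/
theorem windowOddsSupDepthOneIntCan_of_condGoodOddsDepthOneInt
    (h : ∀ (L : ℕ), ∃ c₀ : ℝ, 0 < c₀ ∧ c₀ ≤ 1 ∧ ∀ (c : ℝ), 0 < c → c ≤ c₀ → ∃ pS : ℝ, ∀ (b₀ p₀ : ℝ), 0 < b₀ → pS ≤ p₀ → 0 < p₀ →
      ∃ γ₁ : ℝ, 0 < γ₁ ∧ ∀ (F : T3Family) (γ : ℝ), F.L = L → 0 < γ → γ ≤ γ₁ →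
        ∃ τ : ℕ → ℝ, (∀ J, 0 ≤ τ J) ∧ (∀ a : ℕ, Tendsto (fun J : ℕ => ((J : ℝ) + 1) ^ a * τ J) atTop (𝓝 0)) ∧
          ∀ (J : ℕ) (B : Set (GaugeField (F.P J) 0 (Matrix.specialUnitaryGroup (Fin 2) ℂ))), MeasurableSet B →
            B ⊆ {U | PlaqSmall (θBal F.L γ (c * b₀) p₀ J) U} →
            gibbsK F ℰp γ (J + 1) (descendTo F ℰp J (J + 1) (Nat.le_succ J) ⁻¹' B) ≤
              ENNReal.ofReal (Real.exp (τ J)) *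
                gibbsK F ℰp γ (J + 1) (descendTo F ℰp J (J + 1) (Nat.le_succ J) ⁻¹' B ∩ histGood F ℰp (θBal F.L γ b₀ p₀) (J + 1) J)) :
    ∀ (L : ℕ), ∃ c₀ : ℝ, 0 < c₀ ∧ c₀ ≤ 1 ∧ ∀ (c : ℝ), 0 < c → c ≤ c₀ → ∃ pS : ℝ, ∀ (b₀ p₀ : ℝ), 0 < b₀ → pS ≤ p₀ → 0 < p₀ →
    ∃ γ₁ : ℝ, 0 < γ₁ ∧ ∀ (F : T3Family) (γ : ℝ), F.L = L → 0 < γ → γ ≤ γ₁ →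
      ∃ τ : ℕ → ℝ, (∀ J, 0 ≤ τ J) ∧ (∀ a : ℕ, Tendsto (fun J : ℕ => ((J : ℝ) + 1) ^ a * τ J) atTop (𝓝 0)) ∧
        ∀ (ν : ℕ → (j : ℕ) → Measure (GaugeField (F.P j) 0 (Matrix.specialUnitaryGroup (Fin 2) ℂ))),
          (∀ K, ν K K = T4GenFunBounds.gibbsMeasure (F.P K) ((F.scheme ℰp γ).β K)) →
          (∀ K j, j < K → ν K j = Measure.map (descend F ℰp j) (ν K (j + 1))) →
          ∀ (J : ℕ) (ρ : GaugeField (F.P J) 0 (Matrix.specialUnitaryGroup (Fin 2) ℂ) → ℝ),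
            (∀ U, PlaqSmall (θBal F.L γ (c * b₀) p₀ J) U → 0 < ρ U) →
            ν (J + 1) J = (fieldMeasure _ _ _).withDensity (fun U => ENNReal.ofReal (ρ U)) →
            ContinuousOn ρ {U | PlaqSmall (θBal F.L γ (c * b₀) p₀ J) U} →
            (∀ U : GaugeField (F.P J) 0 (Matrix.specialUnitaryGroup (Fin 2) ℂ), PlaqSmall (θBal F.L γ (c * b₀) p₀ J) U →
                0 < heightDensityCan F γ (Nat.le_succ J) (histGood F ℰp (θBal F.L γ b₀ p₀) (J + 1) J) U) →
            ∃ a₀ : ℝ, ∀ U : GaugeField (F.P J) 0 (Matrix.specialUnitaryGroup (Fin 2) ℂ), PlaqSmall (θBal F.L γ (c * b₀) p₀ J) U →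
              0 ≤ Real.log (ρ U) - a₀ - Real.log (heightDensityCan F γ (Nat.le_succ J) (histGood F ℰp (θBal F.L γ b₀ p₀) (J + 1) J) U) ∧
              Real.log (ρ U) - a₀ - Real.log (heightDensityCan F γ (Nat.le_succ J) (histGood F ℰp (θBal F.L γ b₀ p₀) (J + 1) J) U) ≤ τ J := by
  intro L
  obtain ⟨c₀, hc₀, hc₀1, hc⟩ := h L
  refine ⟨c₀, hc₀, hc₀1, fun c hcpos hcle => ?_⟩
  obtain ⟨pS, hS⟩ := hc c hcpos hcle
  refine ⟨pS, fun b₀ p₀ hb₀ hpS hp₀ => ?_⟩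
  obtain ⟨γ₁, hγ₁, hF⟩ := hS b₀ p₀ hb₀ hpS hp₀
  obtain ⟨γ₂, hγ₂, hW⟩ := FluctuationComparisonRegPrIntLWreg.windowRegularity L b₀ p₀ hb₀ hp₀
  refine ⟨min (min γ₁ γ₂) 1, lt_min (lt_min hγ₁ hγ₂) one_pos, fun F γ hFL hγ hγle => ?_⟩
  have hγ1' : γ ≤ γ₁ := hγle.trans ((min_le_left _ _).trans (min_le_left _ _))
  have hγ2' : γ ≤ γ₂ := hγle.trans ((min_le_left _ _).trans (min_le_right _ _))
  have hγone : γ ≤ 1 := hγle.trans (min_le_right _ _)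
  obtain ⟨τ, hτ0, hτa, hset⟩ := hF F γ hFL hγ hγ1'
  have hW' := hW F γ hFL hγ hγ2'
  refine ⟨τ, hτ0, hτa, fun ν hKK hstep J ρ hρpos hν hρc hpos => ?_⟩
  have hlaw : Measure.map (descendTo F ℰp J (J + 1) (Nat.le_succ J)) (gibbsK F ℰp γ (J + 1)) =
      (fieldMeasure (F.P J) 0 (Matrix.specialUnitaryGroup (Fin 2) ℂ)).withDensity (fun U => ENNReal.ofReal (ρ U)) := by
    rw [← tower_eq_map_descendTo F γ ν hKK hstep (Nat.le_succ J)]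
    exact hν
  obtain ⟨hreg, -⟩ := hW' J (J + 1) (Nat.le_succ J) γ hγ
  -- the interior window lies in the full window (`c ≤ c₀ ≤ 1`, `γ ≤ 1`)
  have hsub : {U : GaugeField (F.P J) 0 (Matrix.specialUnitaryGroup (Fin 2) ℂ) | PlaqSmall (θBal F.L γ (c * b₀) p₀ J) U} ⊆
      {U | PlaqSmall (θBal F.L γ b₀ p₀ J) U} := fun U hU =>
    T3PrintedMinimiserExistence.plaqSmall_of_le
      (T3InteriorExcision.θBal_mul_le (le_of_lt F.hL.2) hγ hγone hb₀ (hcle.trans hc₀1) p₀ J) hU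
  exact ⟨_, window_logOdds_bounds_int F c b₀ p₀ (Nat.le_succ J) hγ (hset J) ρ hρpos hlaw hρc (hsub.trans hreg) hpos⟩

end Summit.QuantumFields.YangMills.Theorems.FluctuationComparisonRegPrIntLSupTailReductionInt

end
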